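import Literature.MathematicalPhysics.QuantumFieldTheory.Balaban1983to89.Beta.BetaContinuity
import Literature.MathematicalPhysics.QuantumFieldTheory.Balaban1983to89.Beta.InfiniteVolumeRate

/-!
# Bałaban's β-functions: the termwise continuity clause (C-pt) ONE LEVEL DOWN — from FINITE-VOLUME continuity and a
# history-uniform volume rate (uniform limits of continuous functions)

T. Bałaban, *Renormalization group approach to lattice gauge field theories. I. Generation of effective actions in a
small field approximation and a coupling constant renormalization in four dimensions*, Commun. Math. Phys. **109**,
249–301 (1987) [Balaban1987RG1] (cell paper B12 = [I]; PDF page = journal page − 248; PDF held: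
`paper:balaban1987-cmp109-rg-i-small-field`).

CITATION HEADER (lean-in-tree rule 2026-08-18).  KERNEL-CHECKED BOOKKEEPING ([folklore] real analysis) for the β
sub-cell of the Bałaban YM₄ reconstruction (audit cell `pub-balaban`; unit `b2b-balaban-beta-an4` gen 2 = row BETA-an4
"k-uniform remainder", journal claim AN4-CVOL; cell records `HOME/GAPS.md` G-an4-1 (iv) / C-an4-2 ((C-pt)), G-beta-4
(`VolumeRate`), `HOME/BETA/REMAINDER-BETA.md` §5).  It sits between two LANDED modules and touches neither:
`…Beta.BetaContinuity` (this row: `continuousOn_secondMoment`, `betaContH_of_kernel`, `betaContH_of_chain`,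
`thm2Printed_of_remainderChain_pt`, `endpointExistence_of_remainderChain_pt` — the reduction (C) ⇐ (C-pt) + uniform
(5.10) decay) and `…Beta.InfiniteVolumeRate` (unit `b2b-balaban-pv04` gen 3: the typed volume-rate hypothesis
`VolumeRate side P Pinf ρ δ` of GAPS G-beta-4 and `VolumeRate.isInfiniteVolumeLimit`), over pv25's torus objects
`Beta.Site`, `Beta.symmRep`, `Beta.torusSecondMoment` (`…Beta.OneLoop`) and pv01's window dictionary `windowMap`,
`siteOf`, `eventually_inWindow` (`…Beta.InfiniteVolume`).  Everything imported is USED BY NAME; nothing is re-proved.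

THE PRINTED TEXT THIS MODULE IS ABOUT (verbatim, from the 300-dpi renders `1987-cmp109-rg-I-small-field-pNNN-x2.png`,
NNN ∈ {016, 045, 050}, under `HOME/b2b-balaban-ref1/pages/1987-cmp109-rg-I-small-field/`, re-read by this seat):
* p. 264 [PDF 16], the passage (1.21)–(1.22): *"This implies Π^{ab}_{j+1,μν}(g_j, x, x′) = δ^{ab}Π_{j+1,μν}(g_j, x − x′),
  Π_{j+1}(g_j, rb, rb′) = Π_{j+1}(g_j, b, b′), (1.21) where Π_{j+1,μν}(g_j, x) is a real valued function, and r is a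
  Euclidean rotation leaving the lattice T^{(j+1)} invariant. Now we take a limit of these functions as T^{(j+1)} ↗ Z^d.
  This limit exists by the localized representation (1.7). The function β_{j+1}(g_j) is defined by β_{j+1}(g_j) =
  −(∂²/∂p₁∂p₂ Π̃_{j+1,12})(g_j, 0) = −(∂²/∂p_μ∂p_ν Π̃_{j+1,μν})(g_j, 0) = Σ_x Π_{j+1,μν}(g_j, x)x_μx_ν (1.22) for μ, ν
  arbitrary, μ ≠ ν, where f̃(p) denotes the Fourier transform of the function f(x), x ∈ Z^d."*
* p. 293 [PDF 45], (5.10): *"The representation (4.37) yields the following inequality |Π_{μν}(x − y)| ≤ O(1)E₀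
  exp(−δ₁|x − y|), (5.10) with a positive constant δ₁ determined by δ₀, κ, and M (e.g., δ₁ = 1/2min{δ₀, κM⁻¹})."*
* p. 298 [PDF 50], last paragraph of §5: *"The β-functions are related in the simple way to the tensors Π by the
  formula (5.42). In fact we should write the superscript (j) at the tensor in the formula (5.42) defining the function
  β_j. We write β_j as explicitly dependent on g_{j−1}, although it depends also on all preceding coupling constants. The
  dependence on g_{j−1} is important and it determines main properties of the renormalization group equations."*  (this
  is the ONLY sentence of [I] on the history dependence; NO continuity of β_j in the preceding coupling constants is
  stated anywhere in [I]).
Print states the EXISTENCE of the limit (1.21) in one sentence, NO rate of convergence in the volume, and NO continuity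
of the kernels or of β_{j+1} in the coupling history (g_0, …, g_{j−1}).

WHAT THIS MODULE DOES.  The β sub-cell's residual input (C) = `FlowStep.BetaContH γ β` (joint continuity of `β_{k+1}`
in the history on the boxes `]0,γ]^{k+1}`, needed by every located consumer of the flow and printed nowhere) was reduced
in `…Beta.BetaContinuity` to (C-pt) = TERMWISE continuity in the history of the INFINITE-VOLUME kernel entries
`Π_{k+1,μν}(g_0,…,g_k; x)` (plus (5.10) decay uniform on each box, which a remainder chain delivers for `Π¹`).  (C-pt) is
a statement about a LIMIT object.  Here it is reduced one level further, by the theorem "a uniform limit of continuous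
functions is continuous" (Mathlib `TendstoUniformlyOn.continuousOn`), to two statements about the objects print
actually constructs and one already-located input:
* (C-fin) FINITE-VOLUME TERMWISE CONTINUITY: for each scale `k`, each torus `T` of the exhausting sequence and each
  torus site `x`, the finite-volume kernel entry `Π_{k+1,μν}^{T}(g_0,…,g_k; x)` — a derivative at zero of the logarithm
  of a finite-dimensional integral ((1.20) p. 264 on the torus) — is continuous in the history on the box.  NOT PRINTED
  (print's only remark on the history dependence is the p. 298 sentence above); a hypothesis here, never asserted.
* (VR-u) A HISTORY-UNIFORM VOLUME RATE: pv04's `VolumeRate side (t ↦ Π^{T_t}(v)) (Π(v)) ρ δ` for every history `v` in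
  the box, with moduli `ρ t → 0` that do NOT depend on `v` (they sit outside the `v`-binder).  This is GAPS G-beta-4's
  located unprinted input (for Bałaban's kernels one expects `ρ t = O(1)e^{−δ′·side t}` with history-free constants from
  the localized representation "(1.7)" invoked on p. 264 — NOT printed, NOT claimed), asked uniformly on the box exactly
  as every other constant of [I] is history-free.
No decay and no `δ > 0` is needed for this step: at a fixed site the rate bound is `ρ t·e^{−δ|x|₁}`, a history-free null
sequence.

CONTENT (every `theorem` kernel-checked; [folklore] real analysis; nothing is asserted about Bałaban's kernels):
1. `continuousOn_of_uniform_rate` — abstract: `F t` continuous on `s` for all `t`, eventually `|F t v − f v| ≤ e t` for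
   all `v ∈ s`, `e t → 0` ⇒ `f` continuous on `s`.
2. `continuousOn_lim_of_volumeRate` — for ONE scale: (C-fin) for the torus kernels + (VR-u) towards a limit kernel
   `Pinf v` along sides `side t → ∞` ⇒ (C-pt) for `Pinf`: every entry `v ↦ Pinf v μ ν x` is continuous on `s`.
   (`continuousOn_torusSecondMoment` records the elementary companion: under (C-fin) the finite-volume second moment
   `torusSecondMoment` — a FINITE sum — is continuous in the history.)
3. `cpt_of_volumeRate` — the family form over all scales `k` on the boxes `Box γ k`: exactly the hypothesis `hcont` of
   `BetaContinuity.betaContH_of_kernel` / `betaContH_of_chain`.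
4. `betaContH_of_kernel_volumeRate`, `betaContH_of_chain_volumeRate` — (C) from the (1.22) dictionary (resp. from a
   remainder chain of row an4, `Beta.RemainderChain.Chain`) with (C-pt) replaced by (C-fin) + (VR-u).
5. `thm2Printed_of_remainderChain_vol`, `endpointExistence_of_remainderChain_vol` — the END-TO-END statements of
   `…Beta.BetaContinuity` §3 with (C-pt) so replaced; hypothesis lists otherwise unchanged ((AF-0), the ε₁-restriction,
   the printed two-sided bound).

HONEST FRAMING.  (C-fin) and (VR-u) are LOCATED UNPRINTED INPUTS, carried as hypotheses (used only to the left of `→`),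
never facts; this module moves the β sub-cell's continuity residual from a limit object to finite-volume objects plus an
input already on the cell's books (G-beta-4), it does not discharge it.  No sign of any β-coefficient is claimed; the
one-loop sign (AF-0)/(M2) remains the sub-cell's wall (BETA-SPEC §6–§7).  The β sub-cell as a whole would, if completed,
make the cell's UV-stability bookkeeping unconditional in its flow input (`FlowStep.BetaPertH` / its replacements) — a
constructive-QFT statement that is NOT the continuum limit, NOT a mass gap, NOT the Clay problem.  Value = kernel
bookkeeping (one located input type folded into another), NOT summit progress.
-/

namespace Literature.MathematicalPhysics.QuantumFieldTheory.Balaban1983to89.Beta.BetaContinuityVolume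

open Literature.MathematicalPhysics.QuantumFieldTheory.Balaban1983to89
open Literature.MathematicalPhysics.QuantumFieldTheory.Balaban1983to89.FlowStep
open Literature.MathematicalPhysics.QuantumFieldTheory.Balaban1983to89.DagBinding
open Literature.MathematicalPhysics.QuantumFieldTheory.Balaban1983to89.FlowStepRuns
open Literature.MathematicalPhysics.QuantumFieldTheory.Balaban1983to89.Beta.RemainderChain
open Literature.MathematicalPhysics.QuantumFieldTheory.Balaban1983to89.Beta.BetaContinuity
open _root_.Filter
open scoped _root_.Topology

noncomputable section

/-! ## 1. Uniform limits of continuous functions (abstract) -/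

/-- **A uniform limit of continuous functions is continuous, rate form**: if every `F t` is continuous on `s`, eventually
`|F t v − f v| ≤ e t` for all `v ∈ s`, and `e t → 0`, then `f` is continuous on `s` (Mathlib
`TendstoUniformlyOn.continuousOn` on the uniform convergence the rate gives). [folklore] -/
theorem continuousOn_of_uniform_rate {X : Type*} [TopologicalSpace X] {s : Set X} {F : ℕ → X → ℝ} {f : X → ℝ}
    {e : ℕ → ℝ} (hcont : ∀ t, ContinuousOn (F t) s) (hrate : ∀ᶠ t in atTop, ∀ v ∈ s, |F t v - f v| ≤ e t)
    (he : Tendsto e atTop (𝓝 0)) : ContinuousOn f s := by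
  have hU : TendstoUniformlyOn F f atTop s := by
    rw [Metric.tendstoUniformlyOn_iff]
    intro ε hε
    filter_upwards [hrate, he.eventually (eventually_lt_nhds hε)] with t ht hte v hv
    rw [Real.dist_eq, abs_sub_comm]
    exact lt_of_le_of_lt (ht v hv) hte
  exact hU.continuousOn (Eventually.of_forall hcont).frequently

/-! ## 2. One scale: (C-pt) for the limit kernel from (C-fin) + (VR-u) -/

section OneScale

variable {d : ℕ} {X : Type*} [TopologicalSpace X] {s : Set X} {side : ℕ → ℕ} [∀ t, NeZero (side t)]

/-- **(C-fin) ⇒ the finite-volume second moment is continuous in the history** (a FINITE sum of continuous functions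
times the constant weights `x_μ x_ν`): the elementary fact that continuity questions about `β^{T}_{k+1}` on a torus
reduce to the kernel entries. [cite: Balaban1987RG1, (1.22) p.264] -/
theorem continuousOn_torusSecondMoment {n : ℕ} [NeZero n] (P : X → Fin d → Fin d → Site d n → ℝ) (μ ν : Fin d)
    (hfin : ∀ x : Site d n, ContinuousOn (fun v => P v μ ν x) s) :
    ContinuousOn (fun v => torusSecondMoment (P v) μ ν) s := by
  unfold torusSecondMoment
  exact continuousOn_finsetSum _ fun x _ => ((hfin x).mul continuousOn_const).mul continuousOn_const

/-- **(C-pt) ONE LEVEL DOWN, one scale.**  Torus kernels `P t v` (volume index `t`, parameter `v`; sides `side t → ∞`)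
with every entry `v ↦ P t v μ ν x` continuous on `s` ((C-fin)), approaching a limit kernel `Pinf v` at pv04's volume
rate `VolumeRate` with moduli `ρ t → 0` INDEPENDENT of `v ∈ s` ((VR-u)) ⇒ every entry `v ↦ Pinf v μ ν y` of the limit
kernel is continuous on `s`.  Proof: at a fixed site `y ∈ ℤ^d`, eventually `y` lies in the window
(`eventually_inWindow`), where the rate reads `|P t v μ ν (siteOf y) − Pinf v μ ν y| ≤ ρ t·e^{−δ|y|₁}` — a `v`-free null
sequence — and §1 applies.  No decay, no sign of `δ` is used. [cite: Balaban1987RG1, (1.21) p.264] -/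
theorem continuousOn_lim_of_volumeRate (hside : Tendsto side atTop atTop)
    (P : (t : ℕ) → X → Fin d → Fin d → Site d (side t) → ℝ) (Pinf : X → B12Beta.Kernel d) {ρ : ℕ → ℝ} {δ : ℝ}
    (hrate : ∀ v ∈ s, VolumeRate side (fun t => P t v) (Pinf v) ρ δ) (hρ : Tendsto ρ atTop (𝓝 0)) (μ ν : Fin d)
    (hfin : ∀ t (x : Site d (side t)), ContinuousOn (fun v => P t v μ ν x) s) (y : Fin d → ℤ) :
    ContinuousOn (fun v => Pinf v μ ν y) s := by
  refine continuousOn_of_uniform_rate (F := fun t v => P t v μ ν (siteOf d (side t) y))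
    (e := fun t => ρ t * Real.exp (-δ * B12Sec2to5.l1 y)) (fun t => hfin t _) ?_ ?_
  · filter_upwards [eventually_inWindow hside y] with t ht v hv
    have h1 := hrate v hv t μ ν (siteOf d (side t) y)
    rwa [windowMap_siteOf d (side t) ht] at h1
  · simpa using hρ.mul_const (Real.exp (-δ * B12Sec2to5.l1 y))

omit [TopologicalSpace X] in
/-- Under the same hypotheses the limit kernel IS the pointwise infinite-volume limit of the torus kernels in pv25's
sense (`IsInfiniteVolumeLimit`, (1.21) as typed) for every parameter — pv04's `VolumeRate.isInfiniteVolumeLimit`, recorded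
here so that (VR-u) is seen to SUBSUME the existence clause of (1.21) on the whole box. [cite: Balaban1987RG1, (1.21) p.264] -/
theorem isInfiniteVolumeLimit_of_volumeRate (hside : Tendsto side atTop atTop)
    (P : (t : ℕ) → X → Fin d → Fin d → Site d (side t) → ℝ) (Pinf : X → B12Beta.Kernel d) {ρ : ℕ → ℝ} {δ : ℝ}
    (hrate : ∀ v ∈ s, VolumeRate side (fun t => P t v) (Pinf v) ρ δ) (hρ : Tendsto ρ atTop (𝓝 0)) :
    ∀ v ∈ s, IsInfiniteVolumeLimit side (fun t => P t v) (Pinf v) :=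
  fun v hv => (hrate v hv).isInfiniteVolumeLimit hρ hside

omit [TopologicalSpace X] in
/-- Non-vacuity of the hypothesis shape of this section: the zero torus kernels converge to the zero kernel at rate
`ρ = 0` (any `δ`). [folklore] -/
example (δ : ℝ) : VolumeRate side (fun t (_ : Fin d) (_ : Fin d) (_ : Site d (side t)) => (0 : ℝ))
    (fun _ _ _ => 0) (fun _ => 0) δ := by
  intro t μ ν x
  simp

end OneScale

/-! ## 3. All scales: the clause `hcont` of `BetaContinuity.betaContH_of_kernel` / `betaContH_of_chain` -/

section Scales

variable {d : ℕ} {side : ℕ → ℕ → ℕ} [∀ k t, NeZero (side k t)]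

/-- **(C-pt) for a family of limit kernels over all scales**, from per-scale torus data: at scale `k`, torus kernels
`PT k t v` on sides `side k t → ∞` (in `t`) with (C-fin) on the box `Box γ k`, and (VR-u) towards `P k v` with
history-free moduli `ρ k t → 0`.  Conclusion = the hypothesis `hcont` of `BetaContinuity.betaContH_of_kernel` /
`betaContH_of_split_kernel` / `betaContH_of_chain`. [cite: Balaban1987RG1, (1.21)–(1.22) p.264] -/
theorem cpt_of_volumeRate (hside : ∀ k, Tendsto (side k) atTop atTop) {γ : ℝ}
    (PT : (k t : ℕ) → (Fin (k + 1) → ℝ) → Fin d → Fin d → Site d (side k t) → ℝ)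
    (P : (k : ℕ) → (Fin (k + 1) → ℝ) → B12Beta.Kernel d) (ρ : ℕ → ℕ → ℝ) (δ : ℕ → ℝ)
    (hrate : ∀ k, ∀ v ∈ Box γ k, VolumeRate (side k) (fun t => PT k t v) (P k v) (ρ k) (δ k))
    (hρ : ∀ k, Tendsto (ρ k) atTop (𝓝 0)) (μ ν : Fin d)
    (hfin : ∀ k t (x : Site d (side k t)), ContinuousOn (fun v => PT k t v μ ν x) (Box γ k)) :
    ∀ k (y : Fin d → ℤ), ContinuousOn (fun v => P k v μ ν y) (Box γ k) :=
  fun k => continuousOn_lim_of_volumeRate (hside k) (PT k) (P k) (hrate k) (hρ k) μ ν (hfin k)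

/-! ## 4. (C) with (C-pt) replaced by (C-fin) + (VR-u) -/

/-- **(C) from the (1.22) dictionary, finite-volume continuity and a history-uniform volume rate**: `β_{k+1}(v) =
Σ_x Π_{k+1}(v; x) x_μ x_ν` on the box, (5.10) decay of `Π_{k+1}(v; ·)` with constants uniform on each box, and per
scale an exhausting torus sequence whose kernels satisfy (C-fin) and (VR-u) towards `Π_{k+1}(v; ·)` ⇒ `BetaContH γ β`.
[cite: Balaban1987RG1, (1.22) p.264 and (5.10) p.293] -/
theorem betaContH_of_kernel_volumeRate (hside : ∀ k, Tendsto (side k) atTop atTop) (μ ν : Fin d) {β : HBeta}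
    {γ : ℝ} (P : (k : ℕ) → (Fin (k + 1) → ℝ) → B12Beta.Kernel d)
    (hβ : ∀ k v, v ∈ Box γ k → β k v = B12Beta.secondMoment (P k v) μ ν)
    (hdec : ∀ k, ∃ C δ₁ : ℝ, 0 < δ₁ ∧ ∀ v ∈ Box γ k, B12Sec2to5.Decay510 (P k v μ ν) C δ₁)
    (PT : (k t : ℕ) → (Fin (k + 1) → ℝ) → Fin d → Fin d → Site d (side k t) → ℝ) (ρ : ℕ → ℕ → ℝ) (δ : ℕ → ℝ)
    (hrate : ∀ k, ∀ v ∈ Box γ k, VolumeRate (side k) (fun t => PT k t v) (P k v) (ρ k) (δ k))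
    (hρ : ∀ k, Tendsto (ρ k) atTop (𝓝 0))
    (hfin : ∀ k t (x : Site d (side k t)), ContinuousOn (fun v => PT k t v μ ν x) (Box γ k)) :
    BetaContH γ β :=
  betaContH_of_kernel μ ν P hβ (cpt_of_volumeRate hside PT P ρ δ hrate hρ μ ν hfin) hdec

/-- **(C) from a REMAINDER CHAIN (row an4) with (C-pt) replaced by (C-fin) + (VR-u) for the remainder kernel `Π¹`**:
the chain's leaves give the (5.10) decay of `Π¹_{k+1}(v; ·)` uniformly in the history (`betaContH_of_chain`); the
termwise continuity of the LIMIT remainder kernel is supplied by finite-volume termwise continuity of torus remainder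
kernels `PT k t v` and a history-uniform volume rate towards `R.P1 k v`.  Inputs by name that no printed source supplies:
the leaves inside `R`, (C-fin), (VR-u). [cite: Balaban1987RG1, (1.21)–(1.22) p.264; Balaban1988RG2Cluster, (2.41) p.21] -/
theorem betaContH_of_chain_volumeRate (hside : ∀ k, Tendsto (side k) atTop atTop) {μ ν : Fin d} {β : HBeta}
    {S : B12Beta.OneLoopSplit β} {γ : ℝ} {c : B13.Consts} {α₂ B₃ c₁ K₀ K₁ : ℝ}
    (R : Chain d μ ν S γ c α₂ B₃ c₁ K₀ K₁) (hs : ChainSigns c α₂ B₃ K₀)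
    (PT : (k t : ℕ) → (Fin (k + 1) → ℝ) → Fin d → Fin d → Site d (side k t) → ℝ) (ρ : ℕ → ℕ → ℝ) (δ : ℕ → ℝ)
    (hrate : ∀ k, ∀ v ∈ Box γ k, VolumeRate (side k) (fun t => PT k t v) (R.P1 k v) (ρ k) (δ k))
    (hρ : ∀ k, Tendsto (ρ k) atTop (𝓝 0))
    (hfin : ∀ k t (x : Site d (side k t)), ContinuousOn (fun v => PT k t v μ ν x) (Box γ k)) :
    BetaContH γ β :=
  betaContH_of_chain R hs (cpt_of_volumeRate hside PT R.P1 ρ δ hrate hρ μ ν hfin)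

/-! ## 5. End to end with (C) so replaced -/

/-- **END TO END, literal grade, (C) ⇐ (C-fin) + (VR-u)**: `B12.Thm2Printed C L` from (AF-0) on all scales, a remainder
chain with the printed signs, the ε₁-restriction, finite-volume termwise continuity + a history-uniform volume rate for
`Π¹`, and the printed upper bound (`BetaContinuity.thm2Printed_of_remainderChain_pt`).  NOT Theorem 2 unconditionally:
(AF-0), the leaves inside `R`, (C-fin), (VR-u) are hypotheses no printed source supplies.
[cite: Balaban1987RG1, Thm 2 (0.31) p.259] -/
theorem thm2Printed_of_remainderChain_vol (hside : ∀ k, Tendsto (side k) atTop atTop) {C : B12.Construction}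
    {β : HBeta} (hgen : ForwardGenerated C β) {μ ν : Fin d} (S : B12Beta.OneLoopSplit β) {γ₀ : ℝ} {c : B13.Consts}
    {α₂ B₃ c₁ K₀ K₁ : ℝ} (R : Chain d μ ν S γ₀ c α₂ B₃ c₁ K₀ K₁) (hs : ChainSigns c α₂ B₃ K₀) {L b β' : ℝ}
    (hL : 1 < L) (hγ₀ : 0 < γ₀) (hb : 0 < b) (hAF0 : ∀ k, 2 * b ≤ S.β0 k)
    (hε₁ : c.ε₁ * remCoeff d c α₂ B₃ c₁ K₀ K₁ ≤ b)
    (PT : (k t : ℕ) → (Fin (k + 1) → ℝ) → Fin d → Fin d → Site d (side k t) → ℝ) (ρ : ℕ → ℕ → ℝ) (δ : ℕ → ℝ)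
    (hrate : ∀ k, ∀ v ∈ Box γ₀ k, VolumeRate (side k) (fun t => PT k t v) (R.P1 k v) (ρ k) (δ k))
    (hρ : ∀ k, Tendsto (ρ k) atTop (𝓝 0))
    (hfin : ∀ k t (x : Site d (side k t)), ContinuousOn (fun v => PT k t v μ ν x) (Box γ₀ k))
    (hup : BetaUpperH β' γ₀ β) : B12.Thm2Printed C L :=
  thm2Printed_of_remainderChain_pt hgen S R hs hL hγ₀ hb hAF0 hε₁
    (cpt_of_volumeRate hside PT R.P1 ρ δ hrate hρ μ ν hfin) hup

/-- **END-STATEMENT grade, (C) ⇐ (C-fin) + (VR-u)**: endpoint existence from a one-loop tail bound (AF-0 on a tail of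
scales), a remainder chain, the ε₁-restriction, finite-volume termwise continuity + a history-uniform volume rate for
`Π¹`, and the printed two-sided bound (`BetaContinuity.endpointExistence_of_remainderChain_pt`).
[cite: Balaban1987RG1, Thm 2 p.259 (first sentence)] -/
theorem endpointExistence_of_remainderChain_vol (hside : ∀ k, Tendsto (side k) atTop atTop) {C : B12.Construction}
    {β : HBeta} (hgen : ForwardGenerated C β) {μ ν : Fin d} (S : B12Beta.OneLoopSplit β) {γ₀ : ℝ} {c : B13.Consts}
    {α₂ B₃ c₁ K₀ K₁ : ℝ} (R : Chain d μ ν S γ₀ c α₂ B₃ c₁ K₀ K₁) (hs : ChainSigns c α₂ B₃ K₀) {b β' : ℝ} {k₀ : ℕ}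
    (hγ₀ : 0 < γ₀) (hb : 0 < b) (hβ' : 0 ≤ β') (hAF0 : ∀ k, k₀ ≤ k → 2 * b ≤ S.β0 k)
    (hε₁ : c.ε₁ * remCoeff d c α₂ B₃ c₁ K₀ K₁ ≤ b)
    (PT : (k t : ℕ) → (Fin (k + 1) → ℝ) → Fin d → Fin d → Site d (side k t) → ℝ) (ρ : ℕ → ℕ → ℝ) (δ : ℕ → ℝ)
    (hrate : ∀ k, ∀ v ∈ Box γ₀ k, VolumeRate (side k) (fun t => PT k t v) (R.P1 k v) (ρ k) (δ k))
    (hρ : ∀ k, Tendsto (ρ k) atTop (𝓝 0))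
    (hfin : ∀ k t (x : Site d (side k t)), ContinuousOn (fun v => PT k t v μ ν x) (Box γ₀ k))
    (hlo : ∀ k, ∀ v ∈ Box γ₀ k, -β' ≤ β k v) (hup : BetaUpperH β' γ₀ β) : EndpointExistence C :=
  endpointExistence_of_remainderChain_pt hgen S R hs hγ₀ hb hβ' hAF0 hε₁
    (cpt_of_volumeRate hside PT R.P1 ρ δ hrate hρ μ ν hfin) hlo hup

end Scales

end

end Literature.MathematicalPhysics.QuantumFieldTheory.Balaban1983to89.Beta.BetaContinuityVolume
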